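import Literature.Geometry.Symplectic.LefschetzSteinOpenBook
import Literature.Geometry.Symplectic.OpenBookGirouxFormTransfer
import Literature.Topology.FourManifolds.AttachmentBoundaryPieces
import HarnessLib

/-!
# The Kas boundary open book of a Lefschetz handlebody is determined by `(K1)`–`(K2)`:
# any two open books satisfying `IsKasOpenBookOf` have the same Giroux forms

Topic `Literature/Geometry/Symplectic`; a proofs-only companion of `LefschetzSteinOpenBook.lean`
(the named fact `Literature.Geometry.Symplectic.palf_stein_supportedByBoundaryOpenBook`,
Akbulut–Ozbagci 2001, Thm. 5 with Gay 2002, Prop. 2.8).  Everything here is PROVED; no definition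
and no named fact is introduced.

The fact quantifies over ALL open books `ob` of a boundary datum `bX` of the Lefschetz handlebody
`X = Base g ∪_h (2-handles)` which are "the Kas boundary open book" in the sense of the Prop-spec
`IsKasOpenBookOf g h D bX.incl ob`: (K1) the binding is the image of `{w = 0} ∩ ∂ Base g`, (K2) the
fibration is the page angle `w/‖w‖` at every point of the UNSURGERED part
`U = incl⁻¹(D.jA(∂ Base g ∖ ⋃ cores))`.  The docstring of `IsKasOpenBookOf` asserts that this pins
`(B, π)` because `U` is dense (its complement in `∂X` being the union of the belt circles of the
handles) and `π` is continuous off `B`, and that Giroux's conditions see the tubes of `ob` only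
through `(B, π)`.  The second claim is `OpenBook.IsGirouxForm.of_binding_eq_of_proj_eq`
(`OpenBookGirouxFormTransfer.lean`); this file proves the first and assembles:

* `MultiAttachmentData.exists_jA_eq_jB_of_lamSq_ne_zero` — in a Kosinski multi-attachment, a
  handle point `jB i b` off the belt disc (`x_λ(b) ≠ 0`) is a base point `jA a`,
  `a = h̄ᵢ(α b)` (Kosinski's identification, `MultiAttachmentData.glue`);
* `IsKasOpenBookOf.compl_binding_subset_closure_unsurgered` — **density**: every point of
  `∂X` off the binding is a limit of points `y` of the unsurgered part with `w ≠ 0` there.  The only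
  points of `∂X` not of the form `jA a` are the belt circles `jB i (0, x_μ)`, `‖x_μ‖ = 1`; such a
  point is the limit, as `t → 0⁺`, of the boundary points `jB i (t, 0, s x_μ) = jA (h̄ᵢ (s, 0, t x_μ))`,
  `s = (1 - t²)^{1/2}` (Kosinski's inversion `α` swaps the moduli of `x_λ` and `x_μ` on `∂D⁴`), and
  `h̄ᵢ (s, 0, t x_μ) → h̄ᵢ (1, 0, 0, 0)`, a point of the attaching circle, where `w ≠ 0` because the
  attaching circles lie in pages (`w = c/2`, `‖c‖ = 1`);
* `IsKasOpenBookOf.binding_eq`, `IsKasOpenBookOf.proj_eq` — two Kas open books of the same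
  `(h, D, bX)` have the same binding and the same fibration off it ((K2) on the dense unsurgered
  part, `toC` injective, continuity of both fibrations off the binding);
* `IsKasOpenBookOf.isGirouxForm_iff`, `IsKasOpenBookOf.supports_iff` — hence the same Giroux
  forms for every plane field: in `palf_stein_supportedByBoundaryOpenBook` it suffices to treat ONE
  Kas open book per boundary datum.

## References
* A. Kas, *On the handlebody decomposition associated to a Lefschetz fibration*, Pacific J. Math.
  89 (1980), 89–104. [Kas1980]
* A. A. Kosinski, *Differential Manifolds* (1993), VI §6 (`M ∪ H^λ`, the inversion `α`).
  [Kosinski1993]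
* J. B. Etnyre, *Lectures on open book decompositions and contact structures*, Clay Math. Proc. 5
  (2006), Def. 2.1, Def. 3.2. [Etnyre2006]
-/

noncomputable section

open scoped Manifold ContDiff Topology
open Set Function Filter Metric

namespace Literature.Geometry.Symplectic

open Literature.Topology.FourManifolds Literature.Topology.FourManifolds.HandleAttachingMap
  Literature.Topology.FourManifolds.LefschetzBase

universe u

/-! ### Handle points off the belt disc are base points -/

section OffBelt

variable {M : Type u} [TopologicalSpace M] [T2Space M] [ChartedSpace (EuclideanHalfSpace 4) M]
  {ι : Type*} [Finite ι] {h : ι → HandleAttachingMap 3 2 M}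
  {X : Type*} [TopologicalSpace X] [ChartedSpace (EuclideanHalfSpace 4) X]

/-- A point `h̄ᵢ y` of the `i`-th attaching tube with `y ∉ S` (i.e. `|x_λ(y)|² ≠ 1`) lies in the
cores-complement `M ∖ ⋃ⱼ h̄ⱼ(S)` (injectivity of `h̄ᵢ` and disjointness of the tubes).
[cite: Kosinski1993, VI §6] -/
theorem _root_.Literature.Topology.FourManifolds.HandleAttachingMap.MultiAttachmentData.apply_mem_coresComplement
    (D : MultiAttachmentData h (𝓡∂ 4) X) (i : ι) (y : ↥(handleTube 3 2))
    (hy : lamSq 2 y.1.1 ≠ 1) :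
    (h i).toFun y ∈ coresComplement h := by
  rw [mem_coresComplement]
  intro j
  by_cases hij : j = i
  · subst hij
    rintro ⟨y', hy', he⟩
    have hyy : y' = y := (h j).injective he
    subst hyy
    exact hy hy'
  · rintro ⟨y', -, he⟩
    exact Set.disjoint_left.1 (D.disjoint hij) ⟨y', rfl⟩ ⟨y, he.symm⟩

/-- **Handle points off the belt disc are base points.**  In a Kosinski multi-attachment, the
image `jB i b` of a point `b ∈ D⁴ ∖ S` with `x_λ(b) ≠ 0` is the image `jA a` of the base point
`a = h̄ᵢ (α b)` (`α` Kosinski's inversion). [cite: Kosinski1993, VI §6] -/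
theorem _root_.Literature.Topology.FourManifolds.HandleAttachingMap.MultiAttachmentData.exists_jA_eq_jB_of_lamSq_ne_zero
    (D : MultiAttachmentData h (𝓡∂ 4) X) (i : ι) (b : ↥(beltPiece 3 2))
    (hb : lamSq 2 b.1.1 ≠ 0) :
    ∃ a : ↥(coresComplement h), D.jA a = D.jB i b := by
  have hb1 : lamSq 2 b.1.1 ≠ 1 := b.2
  set y : ↥(handleTube 3 2) := handleInversionPt b.1 hb hb1 with hy
  have hy1 : lamSq 2 y.1.1 ≠ 1 := (handleInversion_mem hb hb1).2.2
  refine ⟨⟨(h i).toFun y, D.apply_mem_coresComplement i y hy1⟩, ?_⟩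
  rw [D.glue]
  refine ⟨y, hy1, ?_, rfl⟩
  have h0 : 0 < lamSq 2 b.1.1 := lt_of_le_of_ne (lamSq_nonneg 2 _) (Ne.symm hb)
  have h1 : lamSq 2 b.1.1 < 1 :=
    lt_of_le_of_ne (lamSq_le_one (mem_closedBall_zero_iff.1 b.1.2)) hb1
  show b.1.1 = handleInversion 2 (handleInversion 2 b.1.1)
  rw [handleInversion_handleInversion h0 h1]

end OffBelt

/-! ### The approach paths to a belt point -/

section Paths

/-- `|x_λ|²` of the belt-side point `(t, 0, s b₂, s b₃)` is `t²`. [folklore] -/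
theorem lamSq_beltPath (b : EuclideanSpace ℝ (Fin 4)) (s t : ℝ) :
    lamSq 2 (WithLp.toLp 2 ![t, 0, s * b 2, s * b 3] : EuclideanSpace ℝ (Fin 4)) = t ^ 2 := by
  rw [lamSq_two_fin_four]
  simp

/-- `|x_μ|²` of the belt-side point `(t, 0, s b₂, s b₃)` is `s²` when `b₂² + b₃² = 1`.
[folklore] -/
theorem muSq_beltPath (b : EuclideanSpace ℝ (Fin 4)) (hb : b 2 ^ 2 + b 3 ^ 2 = 1) (s t : ℝ) :
    muSq 2 (WithLp.toLp 2 ![t, 0, s * b 2, s * b 3] : EuclideanSpace ℝ (Fin 4)) = s ^ 2 := by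
  rw [muSq_two_fin_four]
  simp
  linear_combination s ^ 2 * hb

/-- The belt-side point `(t, 0, s b₂, s b₃)` with `s² = 1 - t²`, `b₂² + b₃² = 1` is a unit vector.
[folklore] -/
theorem norm_beltPath (b : EuclideanSpace ℝ (Fin 4)) (hb : b 2 ^ 2 + b 3 ^ 2 = 1) {s t : ℝ}
    (hs : s ^ 2 = 1 - t ^ 2) :
    ‖(WithLp.toLp 2 ![t, 0, s * b 2, s * b 3] : EuclideanSpace ℝ (Fin 4))‖ = 1 := by
  have h := lamSq_add_muSq 2 (WithLp.toLp 2 ![t, 0, s * b 2, s * b 3] : EuclideanSpace ℝ (Fin 4))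
  rw [lamSq_beltPath, muSq_beltPath b hb, hs] at h
  have h1 : ‖(WithLp.toLp 2 ![t, 0, s * b 2, s * b 3] : EuclideanSpace ℝ (Fin 4))‖ ^ 2 = 1 := by
    linarith
  nlinarith [norm_nonneg (WithLp.toLp 2 ![t, 0, s * b 2, s * b 3] : EuclideanSpace ℝ (Fin 4))]

/-- `|x_λ|²` of the tube-side point `(s, 0, t b₂, t b₃)` is `s²`. [folklore] -/
theorem lamSq_tubePath (b : EuclideanSpace ℝ (Fin 4)) (s t : ℝ) :
    lamSq 2 (WithLp.toLp 2 ![s, 0, t * b 2, t * b 3] : EuclideanSpace ℝ (Fin 4)) = s ^ 2 := by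
  rw [lamSq_two_fin_four]
  simp

/-- **Kosinski's inversion swaps the two paths**: `α (s, 0, t b₂, t b₃) = (t, 0, s b₂, s b₃)` for
`s = (1 - t²)^{1/2}`, `0 < t < 1` (on `∂D⁴`, `α` keeps the directions of `x_λ`, `x_μ` and swaps
their moduli). [cite: Kosinski1993, VI (6.1)] -/
theorem handleInversion_tubePath (b : EuclideanSpace ℝ (Fin 4)) {t : ℝ} (ht0 : 0 < t)
    (ht1 : t < 1) :
    handleInversion 2
        (WithLp.toLp 2 ![Real.sqrt (1 - t ^ 2), 0, t * b 2, t * b 3] : EuclideanSpace ℝ (Fin 4)) =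
      WithLp.toLp 2 ![t, 0, Real.sqrt (1 - t ^ 2) * b 2, Real.sqrt (1 - t ^ 2) * b 3] := by
  have hpos : 0 < 1 - t ^ 2 := by nlinarith
  have hl :
      lamSq 2 (WithLp.toLp 2 ![Real.sqrt (1 - t ^ 2), 0, t * b 2, t * b 3] : EuclideanSpace ℝ (Fin 4)) =
        1 - t ^ 2 := by
    rw [lamSq_tubePath, Real.sq_sqrt hpos.le]
  have hst : Real.sqrt (1 - (1 - t ^ 2)) = t := by
    rw [sub_sub_cancel, Real.sqrt_sq ht0.le]
  have hs : Real.sqrt (1 - t ^ 2) ≠ 0 := (Real.sqrt_pos.2 hpos).ne'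
  have ht : t ≠ 0 := ht0.ne'
  ext i
  rw [handleInversion_apply, hl, hst]
  fin_cases i
  · simp
    field_simp
  · simp
  · simp
    field_simp
  · simp
    field_simp

end Paths

/-! ### Density of the unsurgered part -/

section Density

variable {g : ℕ} {ι : Type} [Finite ι] {X : Type} [TopologicalSpace X]
  [ChartedSpace (EuclideanHalfSpace 4) X]
  {h : ι → HandleAttachingMap 3 2 (Base g)} {D : MultiAttachmentData h (𝓡∂ 4) X}
  {bX : BoundaryData (𝓡∂ 4) X (𝓡 3)}

/-- **A belt point of `∂X` is a limit of unsurgered boundary points with `w ≠ 0`.**  If the point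
`y ∈ ∂X` is the image `jB i b` of a point `b` of the belt circle of the `i`-th handle
(`x_λ(b) = 0`; then `‖b‖ = 1` since `jB i` preserves boundary points), then `y` lies in the closure
of the set of points `y'` with `incl y' = jA a`, `w(a) ≠ 0`: the points
`jB i (t, 0, s b₂, s b₃) = jA (h̄ᵢ (s, 0, t b₂, t b₃))` (`s = (1 - t²)^{1/2}`, `t = 1/(n+2)`) are
boundary points converging to `y`, and `h̄ᵢ (s, 0, t b₂, t b₃)` converges to the point
`h̄ᵢ (1, 0, 0, 0)` of the attaching circle, which lies in a page, where `w ≠ 0`.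
[cite: Kosinski1993, VI §6] -/
theorem mem_closure_unsurgered_of_belt
    (hpage : ∀ i, ∃ c : ℂ, ‖c‖ = 1 ∧ ∀ θ, (h i).attachingCircle θ ∈ page g c)
    {y : bX.carrier} {i : ι} {b : ↥(beltPiece 3 2)} (hb : D.jB i b = bX.incl y)
    (hlam : lamSq 2 b.1.1 = 0) :
    y ∈ closure {y' : bX.carrier | ∃ a : ↥(coresComplement h),
      bX.incl y' = D.jA a ∧ w g (a : Base g).1 ≠ 0} := by
  -- coordinates of the belt point
  set β : EuclideanSpace ℝ (Fin 4) := b.1.1 with hβ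
  have hnorm : ‖β‖ = 1 := by
    have hbd : b ∈ (𝓡∂ 4).boundary ↥(beltPiece 3 2) := by
      rw [← mem_boundary_iff_of_isSmoothEmbedding (D.hjB i).1 (D.hjB i).2 b, hb, ← bX.range_incl]
      exact ⟨y, rfl⟩
    exact (mem_boundary_beltPiece_iff b).1 hbd
  have hb01 : β 0 = 0 ∧ β 1 = 0 := by
    rw [lamSq_two_fin_four] at hlam
    constructor <;> nlinarith [sq_nonneg (β 0), sq_nonneg (β 1)]
  have hb23 : β 2 ^ 2 + β 3 ^ 2 = 1 := by
    have h1 := lamSq_add_muSq 2 β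
    rw [hlam, muSq_two_fin_four, hnorm] at h1
    linarith
  -- the parameter `t n = 1/(n+2) ∈ (0, 1)`, `t n → 0`
  set t : ℕ → ℝ := fun n => 1 / ((n : ℝ) + 2) with ht
  have ht0 : ∀ n, 0 < t n := fun n => by positivity
  have ht1 : ∀ n, t n < 1 := fun n => by
    have hn : (0 : ℝ) ≤ n := n.cast_nonneg
    rw [ht]
    dsimp only
    rw [div_lt_one (by positivity)]
    linarith
  have htsq : ∀ n, 0 < 1 - t n ^ 2 := fun n => by nlinarith [ht0 n, ht1 n]
  have htend : Tendsto t atTop (𝓝 0) := by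
    have h1 := (tendsto_one_div_add_atTop_nhds_zero_nat :
      Tendsto (fun n : ℕ => 1 / ((n : ℝ) + 1)) atTop (𝓝 0)).comp (tendsto_add_atTop_nat 1)
    refine h1.congr fun n => ?_
    simp only [ht, comp_apply, Nat.cast_add, Nat.cast_one]
    ring
  -- the two paths
  set s : ℕ → ℝ := fun n => Real.sqrt (1 - t n ^ 2) with hs
  have hs2 : ∀ n, s n ^ 2 = 1 - t n ^ 2 := fun n => Real.sq_sqrt (htsq n).le
  have hUnorm : ∀ n,
      ‖(WithLp.toLp 2 ![t n, 0, s n * β 2, s n * β 3] : EuclideanSpace ℝ (Fin 4))‖ = 1 := fun n =>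
    norm_beltPath β hb23 (hs2 n)
  have hYnorm : ∀ n,
      ‖(WithLp.toLp 2 ![s n, 0, t n * β 2, t n * β 3] : EuclideanSpace ℝ (Fin 4))‖ = 1 := fun n =>
    norm_beltPath β hb23 (s := t n) (t := s n) (by rw [hs2]; ring)
  have hUlam : ∀ n,
      lamSq 2 (WithLp.toLp 2 ![t n, 0, s n * β 2, s n * β 3] : EuclideanSpace ℝ (Fin 4)) ≠ 1 :=
      fun n => by
    rw [lamSq_beltPath]
    nlinarith [ht0 n, ht1 n]
  have hYlam0 : ∀ n,
      lamSq 2 (WithLp.toLp 2 ![s n, 0, t n * β 2, t n * β 3] : EuclideanSpace ℝ (Fin 4)) ≠ 0 :=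
      fun n => by
    rw [lamSq_tubePath, hs2]
    exact (htsq n).ne'
  have hYlam1 : ∀ n,
      lamSq 2 (WithLp.toLp 2 ![s n, 0, t n * β 2, t n * β 3] : EuclideanSpace ℝ (Fin 4)) ≠ 1 :=
      fun n => by
    rw [lamSq_tubePath, hs2]
    nlinarith [ht0 n]
  set bseq : ℕ → ↥(beltPiece 3 2) := fun n =>
    ⟨⟨WithLp.toLp 2 ![t n, 0, s n * β 2, s n * β 3], mem_closedBall_zero_iff.2 (hUnorm n).le⟩,
      hUlam n⟩ with hbseq
  set yT : ℕ → ↥(handleTube 3 2) := fun n =>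
    ⟨⟨WithLp.toLp 2 ![s n, 0, t n * β 2, t n * β 3], mem_closedBall_zero_iff.2 (hYnorm n).le⟩,
      by rw [mem_handleTube]; exact hYlam0 n⟩ with hyT
  -- Kosinski's identification: `jA (h̄ᵢ (yT n)) = jB i (bseq n)`
  have hglue : ∀ n, D.jA ⟨(h i).toFun (yT n), D.apply_mem_coresComplement i (yT n) (hYlam1 n)⟩ =
      D.jB i (bseq n) := fun n => by
    rw [D.glue]
    refine ⟨yT n, hYlam1 n, ?_, rfl⟩
    exact (handleInversion_tubePath β (ht0 n) (ht1 n)).symm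
  -- the points `jB i (bseq n)` are boundary points, i.e. in the image of `incl`
  have hbd : ∀ n, ∃ y' : bX.carrier, bX.incl y' = D.jB i (bseq n) := fun n => by
    have h1 : D.jB i (bseq n) ∈ range bX.incl := by
      rw [bX.range_incl, mem_boundary_iff_of_isSmoothEmbedding (D.hjB i).1 (D.hjB i).2,
        mem_boundary_beltPiece_iff]
      exact hUnorm n
    obtain ⟨y', hy'⟩ := h1
    exact ⟨y', hy'⟩
  choose yseq hyseq using hbd
  -- `bseq n → b`, hence `yseq n → y`
  have hbconv : Tendsto bseq atTop (𝓝 b) := by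
    rw [tendsto_subtype_rng, tendsto_subtype_rng]
    have hF : Continuous fun r : ℝ =>
        (WithLp.toLp 2 ![r, 0, Real.sqrt (1 - r ^ 2) * β 2, Real.sqrt (1 - r ^ 2) * β 3] :
          EuclideanSpace ℝ (Fin 4)) := by
      refine (PiLp.continuous_toLp 2 _).comp ?_
      refine continuous_pi fun j => ?_
      fin_cases j <;> simp <;> fun_prop
    have h0 :
        (WithLp.toLp 2 ![(0 : ℝ), 0, Real.sqrt (1 - 0 ^ 2) * β 2, Real.sqrt (1 - 0 ^ 2) * β 3] :
          EuclideanSpace ℝ (Fin 4)) = β := by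
      ext j
      fin_cases j <;> simp [hb01.1, hb01.2]
    have h2 := (hF.tendsto 0).comp htend
    rw [h0] at h2
    exact h2
  have hyconv : Tendsto yseq atTop (𝓝 y) := by
    rw [bX.isSmoothEmbedding.isEmbedding.tendsto_nhds_iff]
    have h1 : bX.incl ∘ yseq = fun n => D.jB i (bseq n) := funext hyseq
    rw [h1, ← hb]
    exact ((D.hjB i).1.isEmbedding.continuous.tendsto b).comp hbconv
  -- along the tube-side path `w ∘ h̄ᵢ` tends to its (nonzero) value at a point of the
  -- attaching circle
  have hA0 : (ptA : EuclideanSpace ℝ (Fin 2)) 0 = 1 := by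
    have h1 := congrArg Complex.re toC_ptA
    simpa using h1
  have hA1 : (ptA : EuclideanSpace ℝ (Fin 2)) 1 = 0 := by
    have h1 := congrArg Complex.im toC_ptA
    simpa using h1
  have hYconv : Tendsto yT atTop (𝓝 (coreTubePt ptA)) := by
    rw [tendsto_subtype_rng, tendsto_subtype_rng]
    have hG : Continuous fun r : ℝ =>
        (WithLp.toLp 2 ![Real.sqrt (1 - r ^ 2), 0, r * β 2, r * β 3] :
          EuclideanSpace ℝ (Fin 4)) := by
      refine (PiLp.continuous_toLp 2 _).comp ?_
      refine continuous_pi fun j => ?_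
      fin_cases j <;> simp <;> fun_prop
    have h0 : (WithLp.toLp 2 ![Real.sqrt (1 - 0 ^ 2), 0, 0 * β 2, 0 * β 3] :
        EuclideanSpace ℝ (Fin 4)) = corePt ptA := by
      ext j
      fin_cases j <;> simp [corePt, hA0, hA1]
    have h2 := (hG.tendsto 0).comp htend
    rw [h0] at h2
    exact h2
  have hw : ∀ᶠ n in atTop, w g ((h i).toFun (yT n) : Base g).1 ≠ 0 := by
    have hcont : Continuous fun z : ↥(handleTube 3 2) => w g ((h i).toFun z : Base g).1 :=
      (contDiff_w g).continuous.comp (continuous_subtype_val.comp (h i).continuous)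
    have hlim := (hcont.tendsto _).comp hYconv
    obtain ⟨c, hc, hcirc⟩ := hpage i
    have hne : w g ((h i).toFun (coreTubePt ptA) : Base g).1 ≠ 0 := by
      have hmem : (h i).attachingCircle ptA ∈ page g c := hcirc ptA
      have hw : w g ((h i).attachingCircle ptA : Base g).1 = c / 2 := hmem.2
      have hc0 : c ≠ 0 := fun h0 => by rw [h0, norm_zero] at hc; exact zero_ne_one hc
      show w g ((h i).attachingCircle ptA : Base g).1 ≠ 0
      rw [hw]
      exact div_ne_zero hc0 two_ne_zero
    exact hlim.eventually_ne hne
  -- conclusion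
  refine mem_closure_of_tendsto hyconv (hw.mono fun n hn => ?_)
  exact ⟨⟨(h i).toFun (yT n), D.apply_mem_coresComplement i (yT n) (hYlam1 n)⟩,
    (hyseq n).trans (hglue n).symm, hn⟩

/-- **The unsurgered part of `∂X` with `w ≠ 0` is dense off the binding of a Kas open book.**
Every point of `∂X` off the binding lies in the closure of the set of points `y` with
`incl y = jA a`, `w(a) ≠ 0`: a point is `jA a` (then `w(a) ≠ 0`, for `w(a) = 0` means `y` is a
binding point by (K1)) or a handle point `jB i b` — off the belt disc again a base point
(`exists_jA_eq_jB_of_lamSq_ne_zero`), on the belt circle a limit of such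
(`mem_closure_unsurgered_of_belt`).  The hypothesis that the attaching circles lie in pages is
the hypothesis of `palf_stein_supportedByBoundaryOpenBook`. [cite: Kas1980] -/
theorem IsKasOpenBookOf.compl_binding_subset_closure_unsurgered {ob : OpenBook bX.carrier}
    (hpage : ∀ i, ∃ c : ℂ, ‖c‖ = 1 ∧ ∀ θ, (h i).attachingCircle θ ∈ page g c)
    (hob : IsKasOpenBookOf g h D bX.incl ob) :
    ob.bindingᶜ ⊆ closure {y' : bX.carrier | ∃ a : ↥(coresComplement h),
      bX.incl y' = D.jA a ∧ w g (a : Base g).1 ≠ 0} := by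
  intro y hy
  have hbase : ∀ a : ↥(coresComplement h), D.jA a = bX.incl y →
      y ∈ closure {y' : bX.carrier | ∃ a : ↥(coresComplement h),
        bX.incl y' = D.jA a ∧ w g (a : Base g).1 ≠ 0} := fun a ha =>
    subset_closure ⟨a, ha.symm, fun hw => hy ((hob.1 y).2 ⟨a, ha.symm, hw⟩)⟩
  rcases D.mem_range_or (bX.incl y) with ⟨a, ha⟩ | ⟨i, b, hb⟩
  · exact hbase a ha
  · by_cases hlam : lamSq 2 b.1.1 = 0
    · exact mem_closure_unsurgered_of_belt hpage hb hlam
    · obtain ⟨a, ha⟩ := D.exists_jA_eq_jB_of_lamSq_ne_zero i b hlam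
      exact hbase a (ha.trans hb)

/-! ### Two Kas open books have the same binding, the same fibration, the same Giroux forms -/

/-- **(K1) determines the binding.** [cite: Kas1980] -/
theorem IsKasOpenBookOf.binding_eq {ob ob' : OpenBook bX.carrier}
    (hob : IsKasOpenBookOf g h D bX.incl ob) (hob' : IsKasOpenBookOf g h D bX.incl ob') :
    ob'.binding = ob.binding := by
  ext y
  rw [hob.1 y, hob'.1 y]

/-- **(K2) determines the fibration on the unsurgered part** (`toC` is injective).
[cite: Kas1980] -/
theorem IsKasOpenBookOf.proj_eq_of_eq_jA {ob ob' : OpenBook bX.carrier}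
    (hob : IsKasOpenBookOf g h D bX.incl ob) (hob' : IsKasOpenBookOf g h D bX.incl ob')
    {y : bX.carrier} {a : ↥(coresComplement h)} (hya : bX.incl y = D.jA a)
    (hw : w g (a : Base g).1 ≠ 0) : ob'.proj y = ob.proj y := by
  have h1 := hob.2 y a hya hw
  have h2 := hob'.2 y a hya hw
  exact Subtype.ext (toC_injective (h2.trans h1.symm))

/-- **(K1)–(K2) determine the fibration off the binding**: two Kas open books of the same
Lefschetz handlebody (attaching circles in pages) on the same boundary datum have the same
angular map at every point off the binding — they agree on the dense unsurgered part and both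
are continuous off the binding (`OpenBook.contMDiffOn_proj`), the circle being Hausdorff.
[cite: Kas1980] -/
theorem IsKasOpenBookOf.proj_eq [T2Space X] {ob ob' : OpenBook bX.carrier}
    (hpage : ∀ i, ∃ c : ℂ, ‖c‖ = 1 ∧ ∀ θ, (h i).attachingCircle θ ∈ page g c)
    (hob : IsKasOpenBookOf g h D bX.incl ob) (hob' : IsKasOpenBookOf g h D bX.incl ob') :
    ∀ y, y ∉ ob.binding → ob'.proj y = ob.proj y := by
  haveI : T2Space bX.carrier := bX.isSmoothEmbedding.isEmbedding.t2Space
  set U : Set bX.carrier := {y' | ∃ a : ↥(coresComplement h),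
    bX.incl y' = D.jA a ∧ w g (a : Base g).1 ≠ 0} with hU
  have hB : ob'.binding = ob.binding := hob.binding_eq hob'
  have hO : IsOpen ob.bindingᶜ := ob.isOpen_compl_binding
  have hf : ContinuousOn ob'.proj ob.bindingᶜ := by
    rw [← hB]
    exact ob'.contMDiffOn_proj.continuousOn
  have hg : ContinuousOn ob.proj ob.bindingᶜ := ob.contMDiffOn_proj.continuousOn
  have heq : EqOn ob'.proj ob.proj (U ∩ ob.bindingᶜ) := by
    rintro y ⟨⟨a, hya, hw⟩, -⟩
    exact hob.proj_eq_of_eq_jA hob' hya hw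
  have hcl : ob.bindingᶜ ⊆ closure (U ∩ ob.bindingᶜ) := fun y hy => by
    have h1 := hO.inter_closure ⟨hy, hob.compl_binding_subset_closure_unsurgered hpage hy⟩
    rwa [inter_comm] at h1
  exact fun y hy => heq.of_subset_closure hf hg inter_subset_right hcl hy

/-- **Two Kas open books of a Lefschetz handlebody have the same Giroux forms** (for every plane
field `ξ` on the boundary datum): they have the same binding and the same fibration off it
(`IsKasOpenBookOf.binding_eq`, `IsKasOpenBookOf.proj_eq`), and a Giroux form sees an open book
only through these (`OpenBook.isGirouxForm_iff_of_binding_eq_of_proj_eq`).  Consequently, in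
`palf_stein_supportedByBoundaryOpenBook` it is enough to produce a Giroux form for ONE Kas open
book of each boundary datum. [cite: Etnyre2006, Def. 3.2] -/
theorem IsKasOpenBookOf.isGirouxForm_iff [T2Space X] {ob ob' : OpenBook bX.carrier}
    (hpage : ∀ i, ∃ c : ℂ, ‖c‖ = 1 ∧ ∀ θ, (h i).attachingCircle θ ∈ page g c)
    (hob : IsKasOpenBookOf g h D bX.incl ob) (hob' : IsKasOpenBookOf g h D bX.incl ob')
    (ξ : bX.carrier → Submodule ℝ (EuclideanSpace ℝ (Fin 3)))
    (α : Literature.Geometry.Kaehler.MForm (𝓡 3) bX.carrier ℝ 1) :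
    ob'.IsGirouxForm ξ α ↔ ob.IsGirouxForm ξ α := by
  haveI : T2Space bX.carrier := bX.isSmoothEmbedding.isEmbedding.t2Space
  exact OpenBook.isGirouxForm_iff_of_binding_eq_of_proj_eq (hob.binding_eq hob')
    (hob.proj_eq hpage hob') ξ α

/-- **Two Kas open books of a Lefschetz handlebody support the same plane fields.**
[cite: Etnyre2006, Def. 3.2] -/
theorem IsKasOpenBookOf.supports_iff [T2Space X] {ob ob' : OpenBook bX.carrier}
    (hpage : ∀ i, ∃ c : ℂ, ‖c‖ = 1 ∧ ∀ θ, (h i).attachingCircle θ ∈ page g c)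
    (hob : IsKasOpenBookOf g h D bX.incl ob) (hob' : IsKasOpenBookOf g h D bX.incl ob')
    (ξ : bX.carrier → Submodule ℝ (EuclideanSpace ℝ (Fin 3))) :
    ob'.Supports ξ ↔ ob.Supports ξ :=
  exists_congr fun α => hob.isGirouxForm_iff hpage hob' ξ α

end Density

end Literature.Geometry.Symplectic

end
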